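import Summits.NavierStokesRegularity.TurbBounds.Results.P2R0Tail
import Summits.NavierStokesRegularity.TurbBounds.Results.P2R3
import Summits.NavierStokesRegularity.TurbBounds.Results.P2R4
import Summits.NavierStokesRegularity.TurbBounds.P2Profile
import HarnessLib

/-!
# The P2 rows from the CITED reduction theorem in mode form (`SpectralReduction`) — v2 restatement of `Results.P2R0/P2R3/P2R4`
(cell `pub-turb` / `turb-bounds`, v2 lane; written by pub-turb-sos, planner-pub-turb-sos-g10-0.)

HONEST FRAMING: rigorous bounds for the stated PDE and boundary conditions; no claim about physical turbulence beyond the bound.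

The v1 row theorems take the named hypothesis `LayerForm.LayerReduction Nu` (cited theorem + this cell's lemmas R-P2a/R-P2b, refereed
prose). By `P2Profile.layerReduction_of_spectralReduction` (R-P2a/R-P2b kernel-checked) they hold from `SpectralForm.SpectralReduction Nu`
— the affine background-method reduction [cite: DingKerswell2019, (13)–(16)] transcribed mode-wise in the Fourier form of [cite: DoeringConstantin1996,
Sec. III] — alone (row P2-R0, whose tail lemma is the tree's theorem `Results.P2R0.tailLemma`) or together with the row's named tail
hypothesis (rows P2-R3, P2-R4):
* `P2R0.nusselt_bound_of_spectralReduction : SpectralReduction Nu → ∀ Ra ≥ 64, Nu Ra ≤ (3/16)·√Ra − 1/2` — ONE hypothesis, and that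
  hypothesis is a published theorem transcribed mode-wise, with nothing cell-made inside it ('transcribed', not 'verbatim' — lead decision 100 (C):
  the display (13)–(16) of [cite: DingKerswell2019] is PDE-level for 2-D stress-free plates and [cite: DoeringGibbon1995, §10.3 (10.3.26)–(10.3.33)]
  is no-slip without balance parameter; the mode-wise form over the no-slip class with balance parameter `s` is this cell's refereed transcription,
  checks R-A / R-B);
* `P2R3.nusselt_bound_of_spectralReduction`, `P2R4.nusselt_bound_of_spectralReduction` (headline row P2-R4: `Nu ≤ C·√Ra − 1/2`,
  `C = 4323705766579/144644500000000 ≤ 0.0298920`, all `Ra ≥ 485809/4`) from `SpectralReduction Nu` and the row's `TailLemma`;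
* `P2R0.spectralConstraint_holds` — UNCONDITIONAL: the spectral constraint (A1) itself (`Q_k ≥ 0` for all `k > 0` on the two-sided
  no-slip class) holds for the explicit P2-R0 profile (`s = 3/2`, `δ = 4/√Ra`, linear layer) at every `Ra ≥ 64` — the complete
  variational content of the row is kernel-checked; only the passage from (A1) to the Nusselt number (the PDE energy argument of the
  cited theorem) is a hypothesis;
* vacuity guards: `spectralReduction_nontrivial` (`Nu ≡ 2` violates `SpectralReduction`, unconditionally) complements
  `SpectralForm.spectralReduction_conduction` (`Nu ≡ 1` satisfies it).
-/

set_option linter.style.longLine false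

noncomputable section

namespace Summit.NavierStokesRegularity.TurbBounds.Results.P2Spectral

open Summit.NavierStokesRegularity.TurbBounds.LayerForm Summit.NavierStokesRegularity.TurbBounds.SpectralForm
open Summit.NavierStokesRegularity.TurbBounds.P2Profile

/-- **(A1) for the P2-R0 profile, unconditional.** For every `Ra ≥ 64`, the mode forms of the profile with `s = 3/2`, linear layers of
thickness `δ = 4/√Ra` (`η′ ≡ 1`) are `≥ 0` for all `k > 0` on the two-sided class — from the tree's unconditional
`Results.P2R0.layer_positivity_holds` (finite certificate + cutoff + cover + the proved tail lemma) via `spectralConstraint_tauP`. -/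
theorem P2R0.spectralConstraint_holds :
    ∀ Ra : ℝ, 64 ≤ Ra → SpectralConstraint Ra (3 / 2) (tauP (4 / Real.sqrt Ra) (fun _ => 1)) :=
  fun Ra hRa => spectralConstraint_tauP (by norm_num) (by norm_num) continuousOn_const Results.P2R0.layer_positivity_holds
    (le_trans (by norm_num) hRa)

/-- **ROW P2-R0 from the cited theorem alone.** For every quantity `Nu` obeying the affine background-method reduction in mode form
(`SpectralReduction`, [cite: DingKerswell2019, (13)–(16)] transcribed mode-wise): `Nu(Ra) ≤ (3/16)·Ra^{1/2} − 1/2` for every `Ra ≥ 64`. Bulk drop,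
rescaling, tail lemma, finite certificate, cutoff and cover are ALL kernel-checked. -/
theorem P2R0.nusselt_bound_of_spectralReduction (Nu : ℝ → ℝ) (h : SpectralReduction Nu) :
    ∀ Ra : ℝ, 64 ≤ Ra → Nu Ra ≤ 3 / 16 * Real.sqrt Ra - 1 / 2 :=
  Results.P2R0.nusselt_bound_of_layerReduction Nu (layerReduction_of_spectralReduction Nu h)

/-- **ROW P2-R3 from `SpectralReduction` and the row's tail hypothesis.** `Nu(Ra) ≤ (24231938953/790020000000)·Ra^{1/2} − 1/2` for every
`Ra ≥ 116964`. -/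
theorem P2R3.nusselt_bound_of_spectralReduction (Nu : ℝ → ℝ) (h : SpectralReduction Nu) (hT : Results.P2R3.TailLemma) :
    ∀ Ra : ℝ, (116964 : ℝ) ≤ Ra → Nu Ra ≤ ((24231938953 : ℝ) / 790020000000) * Real.sqrt Ra - 1 / 2 :=
  Results.P2R3.nusselt_bound Nu (layerReduction_of_spectralReduction Nu h) hT

/-- **HEADLINE ROW P2-R4 from `SpectralReduction` and the row's tail hypothesis** (paper Theorem 1, v2 form):
`Nu(Ra) ≤ (4323705766579/144644500000000)·Ra^{1/2} − 1/2` for every `Ra ≥ 485809/4`. -/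
theorem P2R4.nusselt_bound_of_spectralReduction (Nu : ℝ → ℝ) (h : SpectralReduction Nu) (hT : Results.P2R4.TailLemma) :
    ∀ Ra : ℝ, ((485809 : ℝ) / 4) ≤ Ra → Nu Ra ≤ ((4323705766579 : ℝ) / 144644500000000) * Real.sqrt Ra - 1 / 2 :=
  Results.P2R4.nusselt_bound Nu (layerReduction_of_spectralReduction Nu h) hT

/-- Decimal corollary of the headline row: `Nu(Ra) ≤ 0.029892·Ra^{1/2} − 1/2` for every `Ra ≥ 485809/4`. -/
theorem P2R4.nusselt_bound_decimal_of_spectralReduction (Nu : ℝ → ℝ) (h : SpectralReduction Nu) (hT : Results.P2R4.TailLemma) :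
    ∀ Ra : ℝ, ((485809 : ℝ) / 4) ≤ Ra → Nu Ra ≤ ((7473 : ℝ) / 250000) * Real.sqrt Ra - 1 / 2 :=
  Results.P2R4.nusselt_bound_decimal Nu (layerReduction_of_spectralReduction Nu h) hT

/-- Vacuity guard, unconditional: `SpectralReduction` is NOT provable for every `Nu` — the constant `Nu ≡ 2` violates it (the P2-R0 bound at
`Ra = 64` is `1 < 2`). With `SpectralForm.spectralReduction_conduction` (`Nu ≡ 1` satisfies it) the hypothesis has content. -/
theorem spectralReduction_nontrivial : ¬ SpectralReduction (fun _ => 2) :=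
  fun h => Results.P2R0.layerReduction_nontrivial_holds (layerReduction_of_spectralReduction _ h)

end Summit.NavierStokesRegularity.TurbBounds.Results.P2Spectral

end
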